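import Summits.QuantumFields.YangMills.Theorems.AlphaInputsT3ACv3StartSystemSepChart
import HarnessLib

/-!
# `AlphaInputsT3ACv3StartSystemSepLoc` — START v3.1 (S5)-4b, binder (A4 = hsep), file 2: **TWO TUBES CHARTING ONE PLAQUETTE — CELL LABELS, QUADRANT POINT, VERTEX CHART** —
# cell `ym3-torus`, width seat `ym-ust-19936-w5` (g2)

WHY.  (hsep) of `StartAssembly.dist1_plaqHol_startU_le` says two tubes `Q ≠ Q'` are never active on bonds of one constrained non-deep fine plaquette `q`.  ★w2 g2's (hbox)
(`…StartSystemBox.hbox_of_corners`) already charts all four corners of such a `q` in the tube box of EVERY tube active on it: `q.src = c_Q + u = c_{Q'} + u'`.  Reading this identity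
coordinatewise through `…SepChart.natLabel_eq_of_intCast_eq`∕`natLabel_adj_of_intCast_eq` gives the cell-label relations of this file: a direction transverse to both tubes, or
longitudinal to both, carries the SAME label (★ `src_eq_of_transverse`, ★ `src_eq_of_longitudinal` — `|u_i − u'_i| ≤ 2Rt < L^k`, resp. `≤ 2⌊L^k/2⌋ < L^k`); a direction transverse to
`Q` and longitudinal to `Q'` has `Q'.src i = Q.src i + [1 ≤ u_i]` with `u'_i = u_i + h` or `u_i − h − 1` (★ `src_adj_of_mixed`).  ★ `chartPoint_cases` compares the quadrant endpoint `p` of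
the active bond (`…SepChart.chart_of_tubeActive`) with the corner chart: `p_i ∈ {u_i, u_i + 1}`, the `+1` only in a direction of `q`.  ★ `deep_of_vertexChart`: a plaquette charted within
`R` of the vertex site of an INTERIOR vertex is deep for balls of radius `R + 1` — the ball-side fact the crossing case of (hsep) ends in (`…StartSystemSep`).
HONEST FRAMING.  Lattice bookkeeping only; def-free; count-neutral helper toward the (FL) row of 2′∕2′χ (`--supports stmt-QuantumFields-19936`); (FL)∕`hLift`, the stub, the crux
and the gap are NOT claimed; registry untouched.  YM₃ on T³ is RUNG R3, not Clay.

References: T. Bałaban, Commun. Math. Phys. 102 (1985) 277–309 [Balaban1985Variational] ((11)–(14) pp.279–280); [Balaban1985UV3] Commun. Math. Phys. 102 (1985) 255–275 ((38)–(39) p.266).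
-/

set_option autoImplicit false

noncomputable section

namespace Summit.QuantumFields.YangMills.Theorems.TubeStart

open Literature.MathematicalPhysics.QuantumFieldTheory.Balaban1983to89
open Literature.MathematicalPhysics.QuantumFieldTheory.Balaban1983to89.B10Eq38TorusDomains (toFine plaqsIn cornerSet mem_plaqsIn_iff)
open Summit.QuantumFields.Balaban3D.Carriers
open Summit.QuantumFields.YangMills.Theorems.ModelBox

variable {P : Params} {k : ℕ}

/-! ## §1 Cell labels read through two corner charts of one site -/

section Labels

variable (hNk : P.sitesPerDir 0 = P.sitesPerDir k * P.L ^ k) {Rt : ℕ} {Q Q' : Plaq P k} {u u' : Fin P.d → ℤ}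
  (hu : InTube Q.μ Q.ν Rt (P.L ^ k / 2) u) (hu' : InTube Q'.μ Q'.ν Rt (P.L ^ k / 2) u')
  (hqq : boxSite (cornerSite k Q.src Q.μ Q.ν) u = boxSite (cornerSite k Q'.src Q'.μ Q'.ν) u')
include hNk hu hu' hqq

/-- **★ TRANSVERSE–TRANSVERSE**: a direction transverse to both tubes carries the same cell label (`|u_i − u'_i| ≤ 2Rt < L^k`). [cite: Balaban1985Variational, (11) p.279] -/
theorem src_eq_of_transverse (hRt2 : 2 * Rt + 1 ≤ P.L ^ k) {i : Fin P.d} (hi : i = Q.μ ∨ i = Q.ν) (hi' : i = Q'.μ ∨ i = Q'.ν) : Q.src i = Q'.src i := by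
  have hc := congrFun hqq i
  simp only [boxSite, cornerSite_apply_of_mem k _ hi, cornerSite_apply_of_mem k _ hi'] at hc
  have h1 := hu.abs_le_of_mem hi
  have h2 := hu'.abs_le_of_mem hi'
  rw [abs_le] at h1 h2
  have key := natLabel_eq_of_intCast_eq hNk (ZMod.val_lt (Q.src i)) (ZMod.val_lt (Q'.src i)) (s := ((2 * (P.L ^ k / 2) : ℕ) : ℤ) + u i)
    (s' := ((2 * (P.L ^ k / 2) : ℕ) : ℤ) + u' i) (by rw [abs_lt]; constructor <;> omega) (by simp only [Nat.cast_add, Nat.cast_mul, Nat.cast_ofNat, Int.cast_add, Int.cast_mul, Int.cast_natCast, Int.cast_ofNat] at hc ⊢; linear_combination hc)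
  exact ZMod.val_injective _ key

/-- **★ LONGITUDINAL–LONGITUDINAL**: a direction longitudinal to both tubes carries the same cell label (`|u_i − u'_i| ≤ 2⌊L^k/2⌋ < L^k`, `L^k` odd). [cite: Balaban1985Variational, (11) p.279] -/
theorem src_eq_of_longitudinal {i : Fin P.d} (hi : ¬ (i = Q.μ ∨ i = Q.ν)) (hi' : ¬ (i = Q'.μ ∨ i = Q'.ν)) : Q.src i = Q'.src i := by
  have hc := congrFun hqq i
  simp only [boxSite, cornerSite_apply_of_not_mem k _ hi, cornerSite_apply_of_not_mem k _ hi'] at hc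
  have h1 := hu.abs_le_of_not_mem hi
  have h2 := hu'.abs_le_of_not_mem hi'
  rw [abs_le] at h1 h2
  have hodd := pow_eq_two_mul_half_add_one (P := P) k
  have key := natLabel_eq_of_intCast_eq hNk (ZMod.val_lt (Q.src i)) (ZMod.val_lt (Q'.src i)) (s := ((P.L ^ k / 2 : ℕ) : ℤ) + u i)
    (s' := ((P.L ^ k / 2 : ℕ) : ℤ) + u' i) (by rw [abs_lt]; constructor <;> omega) (by simp only [Nat.cast_add, Nat.cast_mul, Int.cast_add, Int.cast_mul, Int.cast_natCast] at hc ⊢; linear_combination hc)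
  exact ZMod.val_injective _ key

/-- **★ TRANSVERSE FOR `Q`, LONGITUDINAL FOR `Q'`**: the labels are equal or adjacent, decided by the sign of `u_i`: `Q'.src i = Q.src i + [1 ≤ u_i]`, with `u'_i = u_i + h` resp.
`u'_i = u_i − h − 1` (`h = ⌊L^k/2⌋`). [cite: Balaban1985Variational, (11) p.279] -/
theorem src_adj_of_mixed (hRtL : Rt + 1 ≤ P.L ^ k) {i : Fin P.d} (hi : i = Q.μ ∨ i = Q.ν) (hi' : ¬ (i = Q'.μ ∨ i = Q'.ν)) :
    (u i ≤ 0 ∧ u' i = u i + (P.L ^ k / 2 : ℕ) ∧ Q'.src i = Q.src i) ∨ (1 ≤ u i ∧ u' i = u i - (P.L ^ k / 2 : ℕ) - 1 ∧ Q'.src i = Q.src i + 1) := by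
  have hc := congrFun hqq i
  simp only [boxSite, cornerSite_apply_of_mem k _ hi, cornerSite_apply_of_not_mem k _ hi'] at hc
  have h1 := hu.abs_le_of_mem hi
  have h2 := hu'.abs_le_of_not_mem hi'
  rw [abs_le] at h1 h2
  have hodd := pow_eq_two_mul_half_add_one (P := P) k
  obtain ⟨ε, hε, hlab, hεL⟩ := natLabel_adj_of_intCast_eq hNk (a := (Q.src i).val) (a' := (Q'.src i).val) (s := ((2 * (P.L ^ k / 2) : ℕ) : ℤ) + u i)
    (s' := ((P.L ^ k / 2 : ℕ) : ℤ) + u' i) (by rw [abs_lt]; constructor <;> omega) (by simp only [Nat.cast_add, Nat.cast_mul, Nat.cast_ofNat, Int.cast_add, Int.cast_mul, Int.cast_natCast, Int.cast_ofNat] at hc ⊢; linear_combination hc)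
  simp only [Int.cast_natCast, Int.cast_add, ZMod.natCast_zmod_val] at hlab
  rcases hε with rfl | rfl | rfl
  · exfalso; omega
  · left; refine ⟨by omega, by omega, by simpa using hlab⟩
  · right; refine ⟨by omega, by omega, by simpa using hlab⟩

end Labels

/-! ## §2 The quadrant endpoint against the corner chart -/

/-- **★ THE QUADRANT ENDPOINT `p ∈ {w, w + e_dir}` OF AN ACTIVE BOND OF `q` AGAINST THE CORNER CHART `u` OF `q`**: `p_i = u_i`, or `p_i = u_i + 1` in a direction of `q`.
[cite: Balaban1985Variational, (11) p.279] -/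
theorem chartPoint_cases {Rt : ℕ} (hN : 2 * max Rt (P.L ^ k / 2) + 1 ≤ P.sitesPerDir 0) {Q : Plaq P k} {q : Plaq P 0} {u w p : Fin P.d → ℤ} {b : PBond P 0}
    (hsrc : q.src = boxSite (cornerSite k Q.src Q.μ Q.ν) u) (hu : InTube Q.μ Q.ν Rt (P.L ^ k / 2) u) (huμ : InTube Q.μ Q.ν Rt (P.L ^ k / 2) (u + e q.μ))
    (huν : InTube Q.μ Q.ν Rt (P.L ^ k / 2) (u + e q.ν)) (hqb : Plaq.HasBond q b) (hbw : boxSite (cornerSite k Q.src Q.μ Q.ν) w = b.src)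
    (hw : InTube Q.μ Q.ν Rt (P.L ^ k / 2) w) (hp : p = w ∨ p = w + e b.dir) (i : Fin P.d) :
    p i = u i ∨ (p i = u i + 1 ∧ (i = q.μ ∨ i = q.ν)) := by
  have hneq : q.μ ≠ q.ν := ne_of_lt q.hμν
  have inj : ∀ v, InTube Q.μ Q.ν Rt (P.L ^ k / 2) v → boxSite (cornerSite k Q.src Q.μ Q.ν) w = boxSite (cornerSite k Q.src Q.μ Q.ν) v → w = v :=
    fun v hv h => boxSite_injOn _ hN hw.inBox hv.inBox h
  have he : ∀ a j : Fin P.d, e a j = if j = a then (1 : ℤ) else 0 := fun a j => by simp [ModelBox.e, Pi.single_apply]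
  rcases hqb with hb | hb | hb | hb <;> subst hb <;> simp only at hbw hp
  · have hwu : w = u := inj u hu (by rw [hbw, hsrc])
    subst hwu
    rcases hp with rfl | rfl
    · exact Or.inl rfl
    · by_cases hi : i = q.μ
      · right; subst hi; exact ⟨by rw [Pi.add_apply, he, if_pos rfl], Or.inl rfl⟩
      · left; rw [Pi.add_apply, he, if_neg hi, add_zero]
  · have hwu : w = u + e q.μ := inj _ huμ (by rw [hbw, hsrc, boxSite_add_e])
    subst hwu
    rcases hp with rfl | rfl
    · by_cases hi : i = q.μ
      · right; subst hi; exact ⟨by rw [Pi.add_apply, he, if_pos rfl], Or.inl rfl⟩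
      · left; rw [Pi.add_apply, he, if_neg hi, add_zero]
    · by_cases hi : i = q.μ
      · right; subst hi; exact ⟨by rw [Pi.add_apply, Pi.add_apply, he, he, if_pos rfl, if_neg hneq, add_zero], Or.inl rfl⟩
      · by_cases hi' : i = q.ν
        · right; subst hi'; exact ⟨by rw [Pi.add_apply, Pi.add_apply, he, he, if_neg hi, if_pos rfl, add_zero], Or.inr rfl⟩
        · left; rw [Pi.add_apply, Pi.add_apply, he, he, if_neg hi, if_neg hi', add_zero, add_zero]
  · have hwu : w = u + e q.ν := inj _ huν (by rw [hbw, hsrc, boxSite_add_e])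
    subst hwu
    rcases hp with rfl | rfl
    · by_cases hi : i = q.ν
      · right; subst hi; exact ⟨by rw [Pi.add_apply, he, if_pos rfl], Or.inr rfl⟩
      · left; rw [Pi.add_apply, he, if_neg hi, add_zero]
    · by_cases hi : i = q.ν
      · right; subst hi; exact ⟨by rw [Pi.add_apply, Pi.add_apply, he, he, if_pos rfl, if_neg hneq.symm, add_zero], Or.inr rfl⟩
      · by_cases hi' : i = q.μ
        · right; subst hi'; exact ⟨by rw [Pi.add_apply, Pi.add_apply, he, he, if_neg hi, if_pos rfl, add_zero], Or.inl rfl⟩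
        · left; rw [Pi.add_apply, Pi.add_apply, he, he, if_neg hi, if_neg hi', add_zero, add_zero]
  · have hwu : w = u := inj u hu (by rw [hbw, hsrc])
    subst hwu
    rcases hp with rfl | rfl
    · exact Or.inl rfl
    · by_cases hi : i = q.ν
      · right; subst hi; exact ⟨by rw [Pi.add_apply, he, if_pos rfl], Or.inr rfl⟩
      · left; rw [Pi.add_apply, he, if_neg hi, add_zero]

/-! ## §3 Cells by shift pattern; the vertex chart; deep plaquettes at interior vertices -/

/-- The quadrant cell with shift pattern `g`: `cellOf Q (¬g μ, ¬g ν) j = y_j + [j ∈ {μ, ν} ∧ g j]`. [folklore] -/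
theorem cellOf_not_apply (Q : Plaq P k) (g : Fin P.d → Bool) (j : Fin P.d) :
    cellOf Q (!g Q.μ, !g Q.ν) j = Q.src j + if (j = Q.μ ∨ j = Q.ν) ∧ g j = true then 1 else 0 := by
  have hne : Q.μ ≠ Q.ν := ne_of_lt Q.hμν
  rw [cellOf_apply]
  by_cases hμ : j = Q.μ
  · subst hμ; cases hg : g Q.μ <;> simp_all
  · by_cases hν : j = Q.ν
    · subst hν; cases hg : g Q.ν <;> simp_all
    · simp_all

/-- The shifted site's coordinates. [folklore] -/
theorem shiftBy_apply (y : Site P k) (f : Fin P.d → Bool) (j : Fin P.d) : shiftBy y f j = y j + if f j then 1 else 0 := rfl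

/-- The vertex site IS the corner site's transverse presentation: `vertexSite y i = y_i·L^k + 2⌊L^k/2⌋` (`L^k` odd). [folklore] -/
theorem vertexSite_apply_two_mul_half (y : Site P k) (i : Fin P.d) :
    vertexSite k y i = (((y i).val * P.L ^ k + 2 * (P.L ^ k / 2) : ℕ) : ZMod (P.sitesPerDir 0)) := by
  have := pow_eq_two_mul_half_add_one (P := P) k
  unfold vertexSite
  congr 2; omega

/-- **★ A PLAQUETTE CHARTED WITHIN `R` OF THE VERTEX SITE OF AN INTERIOR VERTEX IS DEEP** for the balls of radius `R + 1` around the interior vertex sites: all four bonds are ball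
bonds of that vertex. [cite: Balaban1985Variational, (11) p.279] -/
theorem deep_of_vertexChart {R Rb : ℕ} (hRb : R + 1 ≤ Rb) (Ω : Set (Site P 0)) {y : Site P k} (hy : IsInteriorVertex k Ω y) {q : Plaq P 0} {v : Fin P.d → ℤ}
    (hv : InBox R v) (hq : q.src = boxSite (vertexSite k y) v) : Plaq.Deep (IsBallΩ k Ω) (fun c b => BallBond c Rb b) q := by
  have hneq : q.μ ≠ q.ν := ne_of_lt q.hμν
  have he : ∀ a j : Fin P.d, e a j = if j = a then (1 : ℤ) else 0 := fun a j => by simp [ModelBox.e, Pi.single_apply]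
  have hRb' : (R : ℤ) + 1 ≤ (Rb : ℤ) := by exact_mod_cast hRb
  have h0 : InBox Rb v := hv.mono (by omega)
  have h1 : ∀ a, InBox Rb (v + e a) := fun a j => by
    have := hv j
    rw [Pi.add_apply, he]
    rw [abs_le] at this ⊢
    split_ifs <;> constructor <;> linarith
  have h2 : InBox Rb (v + e q.μ + e q.ν) := fun j => by
    have := hv j
    rw [Pi.add_apply, Pi.add_apply, he, he]
    rw [abs_le] at this ⊢
    by_cases hj : j = q.ν
    · rw [if_pos hj, if_neg (fun h => hneq (h.symm.trans hj))]; constructor <;> linarith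
    · rw [if_neg hj]; split_ifs <;> constructor <;> linarith
  refine ⟨vertexSite k y, ⟨y, hy, rfl⟩, fun b hb => ?_⟩
  rcases hb with rfl | rfl | rfl | rfl
  · exact ⟨v, h0, h1 _, hq.symm⟩
  · exact ⟨v + e q.μ, h1 _, h2, by rw [boxSite_add_e, hq]⟩
  · exact ⟨v + e q.ν, h1 _, by rw [← add_e_comm]; exact h2, by rw [boxSite_add_e, hq]⟩
  · exact ⟨v, h0, h1 _, hq.symm⟩

end Summit.QuantumFields.YangMills.Theorems.TubeStart

end
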